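import Summits.HodgeConjecture.HodgeConjecture.Theses.QbarEnvelope
import Summits.HodgeConjecture.HodgeConjecture.Theses.BoundaryReadout
import Summits.HodgeConjecture.HodgeConjecture.Theses.PeriodDeficiency
import Summits.HodgeConjecture.HodgeConjecture.Theses.PeriodsPolice
import Summits.HodgeConjecture.HodgeConjecture.Theorems.QbarEnvelopeEnvelopeStubNumberFieldModel
import Summits.HodgeConjecture.HodgeConjecture.Theorems.AnchorTransportAnchorExistenceStubDefinableOfRigid
import Literature.AlgebraicGeometry.HodgeTheory.AlgebraicCyclesDefinedOverQbarSpread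
import Literature.AlgebraicGeometry.HodgeTheory.IsoTransport
import Literature.AlgebraicGeometry.HodgeTheory.HodgeConjectureQbarVoisin
import Literature.AlgebraicGeometry.Motives.CurveNet
import HarnessLib

/-!
# `HCOverNumberFields` (stmt-HodgeConjecture-1070) ⟺ `HodgeConjectureQbar` (stmt-HodgeConjecture-11596)

Support file for the crux item stmt-HodgeConjecture-1070 (`--supports`; it closes nothing): the number-field
typing of "the Hodge conjecture for varieties definable over `ℚ̄`",

  `QbarEnvelope.HCOverNumberFields` (= `BoundaryReadout.HCOverNumberFields`, one item):
  `∀ n X, IsSmoothProjective n X → (∃ K [NumberField K] (σ : K →+* ℂ) X₀, X ≅ X₀ ×_{K,σ} ℂ) → HodgeConjectureFor n X`,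

is EQUIVALENT to the `ℚ̄`-typing used by the routes `PeriodDeficiency`, `PeriodsPolice`, `FiniteTreeOfFlavours`,

  `PeriodDeficiency.HodgeConjectureQbar` (stmt-11596; verbatim the antecedent of `PeriodsPolice.QbarDescent`, stmt-1200):
  `∀ (σ : ℚ̄ →+* ℂ) n X₀, IsSmoothProjective n (X₀ ×_{ℚ̄,σ} ℂ) → HodgeConjectureFor n (X₀ ×_{ℚ̄,σ} ℂ)`.

Consequences recorded here: the two items are ONE open problem (`hcOverNumberFields_iff_hodgeConjectureQbar`);
`PeriodsPolice.QbarDescent` is literally "stmt-1070 ⇒ the summit" (`qbarDescent_iff_hcOverNumberFields_imp`).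
The informal remark is on file since the second route review of `QbarEnvelope` (refuter note on stmt-1070,
2026-08-15: "definable over a number field `K →σ ℂ` ⟺ definable over `ℚ̄ →σ̃ ℂ` for finite-type `X`"); this
file makes it a theorem on the tree's real carriers.

## Proof

* `ℚ̄ ⇒ number field` (`hcOverNumberFields_of_hodgeConjectureQbar`). An embedding `σ : K →+* ℂ` of a number
  field factors as `τ ∘ i` with `i : K →+* ℚ̄`, `τ : ℚ̄ →+* ℂ` (`exists_comp_eq_of_numberField`: `K/ℚ` is
  algebraic, so `i` exists by Mathlib's `IsAlgClosed.lift`; `ℚ̄` is algebraic over `K` through `i`, so the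
  `K`-algebra map `τ` into the algebraically closed `K`-algebra `(ℂ, σ)` exists, `IsAlgClosed.lift` again).
  Base change is transitive (`QbarFibreAnchors.iso_baseChangeHom_comp_of_rigid`, Mathlib `Over.pullbackComp`):
  `X ≅ X₀ ⊗_{K,τ∘i} ℂ ≅ (X₀ ⊗_{K,i} ℚ̄) ⊗_{ℚ̄,τ} ℂ`; smooth projectivity and `HodgeConjectureFor` transport
  along this isomorphism (`IsSmoothProjective.of_iso`; `hodgeConjectureFor_of_iso'` from
  `IsoTransport.nonempty_hodgeModel_iff_of_iso` and `forall_hodgeClass_mem_algebraicClasses_iff_of_iso`).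
* `number field ⇒ ℚ̄` (`hodgeConjectureQbar_of_hcOverNumberFields`). If `X₀ ⊗_{ℚ̄,τ} ℂ` is smooth
  projective then so is `X₀` over `ℚ̄` (descent, `isSmoothProjective_of_baseChangeHom`), hence
  `X₀ ≅ X₁ ⊗_{K,ι} ℚ̄` for a number field `K` (EGA IV₃ 8.8.2 (ii); Görtz–Wedhorn I Prop. 10.75 — the landed
  `Theorems.stub_numberFieldModel`), and `X₀ ⊗_τ ℂ ≅ X₁ ⊗_{K,τ∘ι} ℂ` by transitivity again.

Everything used is proved in the tree or in Mathlib; no named fact is assumed (standard axioms).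

## Main results

* `hcOverNumberFields_iff_hodgeConjectureQbar : QbarEnvelope.HCOverNumberFields ↔ PeriodDeficiency.HodgeConjectureQbar`
* `boundaryReadout_hcOverNumberFields_iff_hodgeConjectureQbar` (the `BoundaryReadout` spelling)
* `qbarDescent_iff_hcOverNumberFields_imp : PeriodsPolice.QbarDescent ↔ (QbarEnvelope.HCOverNumberFields → HodgeConjecture)`

## References

* A. Grothendieck, J. Dieudonné, EGA IV₃ (Publ. Math. IHÉS 28, 1966), Thm. 8.8.2 (ii). [EGAIV3]
* U. Görtz, T. Wedhorn, *Algebraic Geometry I*, 2nd ed. (2020), Prop. 10.75, (10.13). [GortzWedhorn2020]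
* C. Voisin, *Hodge loci and absolute Hodge classes*, Compositio Math. 143 (2007), Rem. 1.4 (the statement
  "HC over `ℚ̄`" is independent of the embedding). [Voisin2007HodgeLoci]
* R. Hartshorne, *Algebraic Geometry* (1977), II.3 (base extension). [Hartshorne1977]
-/

-- every declaration of this problem lives in `Summit.HodgeConjecture.HodgeConjecture.…` (summit = sub-problem)
set_option linter.dupNamespace false

noncomputable section

namespace Summit.HodgeConjecture.HodgeConjecture.Theorems.HCOverNumberFieldsTransfer

open CategoryTheory AlgebraicGeometry
open Literature.AlgebraicGeometry.Motives Literature.AlgebraicGeometry.HodgeTheory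
open Summit.HodgeConjecture.HodgeConjecture.Theorems (stub_numberFieldModel)
open Summit.HodgeConjecture.HodgeConjecture.Theorems.QbarFibreAnchors (iso_baseChangeHom_comp_of_rigid)
open Summit.HodgeConjecture.HodgeConjecture.Theses.PeriodDeficiency (HodgeConjectureQbar)
open Summit.HodgeConjecture.HodgeConjecture.Theses.QbarEnvelope (HCOverNumberFields)

/-- **Every embedding of a number field into `ℂ` factors through `ℚ̄`.** For a number field `K` and
`σ : K →+* ℂ` there are `i : K →+* ℚ̄` and `τ : ℚ̄ →+* ℂ` with `τ ∘ i = σ`: `K/ℚ` is algebraic, so `i` exists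
(`IsAlgClosed.lift`); `ℚ̄` is algebraic over `K` through `i` (tower over `ℚ`), so the `K`-algebra map `τ`
into the algebraically closed `K`-algebra `(ℂ, σ)` exists (`IsAlgClosed.lift`). [folklore] -/
theorem exists_comp_eq_of_numberField (K : Type) [Field K] [NumberField K] (σ : K →+* ℂ) :
    ∃ (i : K →+* AlgebraicClosure ℚ) (τ : AlgebraicClosure ℚ →+* ℂ), τ.comp i = σ := by
  classical
  haveI : Algebra.IsAlgebraic ℚ K := Algebra.IsAlgebraic.of_finite ℚ K
  let i : K →ₐ[ℚ] AlgebraicClosure ℚ := IsAlgClosed.lift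
  letI : Algebra K (AlgebraicClosure ℚ) := i.toRingHom.toAlgebra
  letI : Algebra K ℂ := σ.toAlgebra
  haveI : IsScalarTower ℚ K (AlgebraicClosure ℚ) :=
    IsScalarTower.of_algebraMap_eq fun x ↦ by
      show algebraMap ℚ (AlgebraicClosure ℚ) x = i.toRingHom (algebraMap ℚ K x)
      simp
  haveI : Algebra.IsAlgebraic ℚ (AlgebraicClosure ℚ) := AlgebraicClosure.isAlgebraic ℚ
  haveI : Algebra.IsAlgebraic K (AlgebraicClosure ℚ) := Algebra.IsAlgebraic.tower_top (K := ℚ) K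
  let τ : AlgebraicClosure ℚ →ₐ[K] ℂ := IsAlgClosed.lift
  exact ⟨i.toRingHom, τ.toRingHom, RingHom.ext fun x ↦ τ.commutes x⟩

/-- **`HodgeConjectureFor` transports along isomorphisms of `ℂ`-schemes** (no smoothness hypothesis):
Hodge models, rational `(p,p)` classes and algebraic classes all do (`IsoTransport`). Primed to keep clear of
the smooth-projective variant `AnchorsAtGenericHodgeLocusPoints.hodgeConjectureFor_of_iso`.
[cite: SerreGAGA1956, §2] [cite: GrothendieckTopology1969, §1] -/
theorem hodgeConjectureFor_of_iso' {n : ℕ} {X X' : SchemeOver ℂ} (e : X' ≅ X)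
    (h : HodgeConjectureFor n X) : HodgeConjectureFor n X' :=
  ⟨(nonempty_hodgeModel_iff_of_iso e).2 h.1,
    fun p ↦ (forall_hodgeClass_mem_algebraicClasses_iff_of_iso (n := n) e p).2 (h.2 p)⟩

/-- **`ℚ̄`-form ⇒ number-field form.** If the Hodge conjecture holds for every smooth projective
`X₀ ×_{ℚ̄,τ} ℂ`, it holds for every smooth projective complex variety definable over a number field:
`X ≅ X₀ ⊗_{K,σ} ℂ = X₀ ⊗_{K,τ∘i} ℂ ≅ (X₀ ⊗_{K,i} ℚ̄) ⊗_{ℚ̄,τ} ℂ`. [cite: Voisin2007HodgeLoci, Rem. 1.4]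
[cite: Hartshorne1977, II.3] -/
theorem hcOverNumberFields_of_hodgeConjectureQbar (h : HodgeConjectureQbar) : HCOverNumberFields := by
  rintro n X hX ⟨K, _, _, σ, X₀, ⟨e⟩⟩
  obtain ⟨i, τ, hτ⟩ := exists_comp_eq_of_numberField K σ
  subst hτ
  obtain ⟨e₂⟩ := iso_baseChangeHom_comp_of_rigid i τ X₀
  have e' : X ≅ (baseChangeHom τ).obj ((baseChangeHom i).obj X₀) := e ≪≫ e₂.symm
  exact hodgeConjectureFor_of_iso' e' (h τ (hX.of_iso e'))

/-- **Number-field form ⇒ `ℚ̄`-form.** If the Hodge conjecture holds for every smooth projective complex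
variety definable over a number field, it holds for every smooth projective `X₀ ×_{ℚ̄,τ} ℂ`: `X₀` is smooth
projective over `ℚ̄` (descent, `isSmoothProjective_of_baseChangeHom`), hence `X₀ ≅ X₁ ⊗_{K,ι} ℚ̄` for a number
field `K` (the landed `Theorems.stub_numberFieldModel`), and `X₀ ×_τ ℂ ≅ X₁ ⊗_{K,τ∘ι} ℂ`.
[cite: EGAIV3, Thm. 8.8.2 (ii)] [cite: GortzWedhorn2020, Prop. 10.75] -/
theorem hodgeConjectureQbar_of_hcOverNumberFields (h : HCOverNumberFields) : HodgeConjectureQbar := by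
  intro τ n X₀ hX
  have hX₀ : IsSmoothProjective n X₀ := isSmoothProjective_of_baseChangeHom τ X₀ hX
  obtain ⟨K, _, _, ι, X₁, ⟨e₁⟩⟩ := stub_numberFieldModel X₀ hX₀
  obtain ⟨e₂⟩ := iso_baseChangeHom_comp_of_rigid ι τ X₁
  exact h hX ⟨K, inferInstance, inferInstance, τ.comp ι, X₁, ⟨(baseChangeHom τ).mapIso e₁ ≪≫ e₂⟩⟩

/-- **stmt-1070 ⟺ stmt-11596.** `QbarEnvelope.HCOverNumberFields ↔ PeriodDeficiency.HodgeConjectureQbar`.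
[cite: Voisin2007HodgeLoci, Rem. 1.4] [cite: EGAIV3, Thm. 8.8.2 (ii)] -/
theorem hcOverNumberFields_iff_hodgeConjectureQbar : HCOverNumberFields ↔ HodgeConjectureQbar :=
  ⟨hodgeConjectureQbar_of_hcOverNumberFields, hcOverNumberFields_of_hodgeConjectureQbar⟩

/-- The `BoundaryReadout` spelling of the shared item (same statement, `Iff.rfl` with `QbarEnvelope`'s) is
equivalent to `HodgeConjectureQbar` as well. [cite: EGAIV3, Thm. 8.8.2 (ii)] -/
theorem boundaryReadout_hcOverNumberFields_iff_hodgeConjectureQbar :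
    Summit.HodgeConjecture.HodgeConjecture.Theses.BoundaryReadout.HCOverNumberFields ↔ HodgeConjectureQbar :=
  hcOverNumberFields_iff_hodgeConjectureQbar

/-- **`PeriodsPolice.QbarDescent` is literally "stmt-1070 ⇒ the summit"**: its antecedent is the body of
`HodgeConjectureQbar` verbatim, which is equivalent to `HCOverNumberFields`. [cite: Voisin2007HodgeLoci, Prop. 1.2] -/
theorem qbarDescent_iff_hcOverNumberFields_imp :
    Summit.HodgeConjecture.HodgeConjecture.Theses.PeriodsPolice.QbarDescent ↔
      (HCOverNumberFields → _root_.HodgeConjecture) :=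
  ⟨fun h hC ↦ h (hodgeConjectureQbar_of_hcOverNumberFields hC),
    fun h hQ ↦ h (hcOverNumberFields_of_hodgeConjectureQbar hQ)⟩

end Summit.HodgeConjecture.HodgeConjecture.Theorems.HCOverNumberFieldsTransfer

end
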